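import Literature.NumberTheory.LFunctions.ZetaScrewGrowthMoments
import Literature.NumberTheory.LFunctions.ZetaScrewProp31Proofs
import Literature.NumberTheory.LFunctions.WeilExplicitFormulaProofs
import Literature.NumberTheory.LFunctions.FordZetaZeroRecipSqSum
import Literature.Analysis.Fourier.FourierUniquenessL1
import Mathlib.Analysis.Fourier.RiemannLebesgueLemma
import Mathlib.Analysis.Normed.Group.FunctionSeries
import Mathlib.Analysis.Calculus.ParametricIntegral
import HarnessLib

/-!
# Suzuki JLMS 2023, §6.2: the null series of a degenerate vector (the content of Thm 6.1) — PROOFS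

LINE 1 — LABEL: RH-FREE corpus THEOREM (proof-only module: no definition, no named fact). The
result is unconditional: IF the hermitian form `⟨·,·⟩_{G_g,a}` is degenerate on `L²(−a,a)` for some
`a`, THEN a non-trivial null series `Σ_γ w_γ(e^{iγt} − 1)/γ² = 0` holds on `(−a,a)`. Suzuki's
Thm 6.1 ("Suppose that the RH is false. Then …", the named fact `Suzuki2023_thm61` of
`ZetaScrewGrowthMoments.lean`) is this statement composed with the sufficiency half of Thm 1.4
(`Suzuki2023_thm14`, RH-EQUIVALENT, Yoshida's strategy §5.2 — NOT in the tree); the composition is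
the one-line corollary in the sibling `ZetaScrewThm61Proofs.lean`. bears_on: LADDER-RH B-C/B-P
(COLUMN 6, de Branges–Suzuki corpus; objects `Ψ`, `G_g` = COLUMN 1).
WHAT THIS IS NOT: nobody asserts that the form is degenerate (under RH it is not:
`isScrewFormNondegenerate_of_riemannHypothesis`); an implication between printed statements is not
progress toward RH; nothing here bears on the truth of RH.

Source: M. Suzuki, *Aspects of the screw function corresponding to the Riemann zeta-function*,
J. Lond. Math. Soc. (2) 108 (2023) 1448–1487 = arXiv:2206.03682 [Suzuki2023], §6.2 "Eigenvalues"
(held text `paper-arxiv-2206.03682` p0016:L60–158) and Thm 6.1 (p0016:L159–167).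

## The printed argument and this formalisation

Printed (§6.2): for an eigenfunction `φ` of `𝖦_g[a]` with eigenvalue `λ`,
`λφ(t) = 𝟏_{[−a,a]}(t) Σ_γ ((φ̂(−γ) − φ̂(0))/γ)(e^{iγt} − 1)/γ` by (1.9); "if `λ = 0`, we have
`Σ_γ w_γ (e^{iγt} − 1)/γ² = 0` for `t ∈ (−a,a)` by writing `w_γ = φ̂(−γ) − φ̂(0)`. Further,
`w_γ ≠ 0` for some `γ` by Lemma 2.1, since `φ̂(z)` is a non-constant entire function of the
exponential type."

Here, in the tree's coordinates (`γ = i(ρ − ½)`, zeros `ρ ∈ riemannZetaNontrivialZeros` with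
multiplicity `m(ρ) = riemannZetaZeroOrder ρ`, so `e^{iγt} = e^{−(ρ−½)t}`, `γ² = −(ρ−½)²`,
`φ̂(−γ) − φ̂(0) = ∫_{(−a,a)}(e^{(ρ−½)u} − 1)φ(u)du =: D_φ(ρ − ½)`):

* degeneracy on `L²(−a,a)` (`¬ IsScrewFormNondegenerate a`: some `0 ≠ φ ∈ L²` with
  `⟨φ,φ₂⟩_{G_g,a} = 0` for all `φ₂ ∈ L²`; by `Suzuki2023_thm14_eigenvalue_holds` this is "`0` is an
  eigenvalue of `𝖦_g[a]`") is fed into (3.1) (`Suzuki2023_eq301`, taken as the hypothesis `h301`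
  in its printed form): `Σ_ρ ∫ s_ρ(t) conj φ₂(t) dt = 0` for every `φ₂ ∈ L²(−a,a)`, where
  `s_ρ(t) = w(ρ)(1 − e^{−(ρ−½)t})/(ρ−½)²`, `w(ρ) = m(ρ) D_φ(ρ − ½)`;
* `|s_ρ(t)| ≤ m(ρ)(e^{a/2}+1)²‖φ‖₁/|ρ − ½|²` on the window and `Σ_ρ m(ρ)/|ρ − ½|² < ∞`
  (tree: `ZetaScrewProp31.summable_zeroOrder_div_norm_sub_half_sq`), so
  `S = Σ_ρ s_ρ` is continuous on `[−a,a]` and the series may be integrated termwise against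
  `conj φ₂ ∈ L¹` (dominated summation): `∫ S conj φ₂ = 0` for all `φ₂ ∈ L²(−a,a)`; with `φ₂ = S`,
  `S = 0` a.e., hence everywhere on the open window (continuity) — the printed null series;
* `w ≠ 0`: otherwise `D_φ` (entire, of exponential type: differentiation under the integral sign)
  vanishes at `ρ − ½` for every zero, i.e. `F(z) = D_φ(−iz)` takes the value `0` at all zeros of
  `ξ(½ − iz)`, so `F ≡ 0` by Lemma 2.1 (`Suzuki2023_lemma21`, hypothesis `h21`, discharged in the
  tree by `Suzuki2023_lemma21_holds`); then all exponential moments of `φ` vanish, the Fourier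
  transform of `𝟙_{(−a,a)}φ` is constant, hence `0` (Riemann–Lebesgue), hence `φ = 0` a.e.
  (`Literature.Analysis.Fourier.ae_eq_zero_of_forall_fourier_eq_zero`) — contradicting `φ ≠ 0`.
  (The same three "exponential moment" lemmas appear, privately, in `ZetaScrewLemma21Proofs.lean`
  Part II, where they serve Thm 1.3 "Moreover"; they are re-proved here to keep this module's
  imports on long-built files.)

The two cited inputs (3.1) and Lemma 2.1 are taken as hypotheses `h301`, `h21` (both are tree
theorems: `Suzuki2023_eq301`, `Suzuki2023_lemma21_holds`); the sibling `ZetaScrewThm61Proofs.lean`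
plugs them in and composes with Thm 1.4.

## References

* M. Suzuki, J. Lond. Math. Soc. (2) 108 (2023) 1448–1487; arXiv:2206.03682, §6.2, Thm 6.1,
  Lemma 2.1, eq. (3.1). [Suzuki2023]
* E. C. Titchmarsh, *The Theory of the Riemann Zeta-Function*, 2nd ed., §9.2 (`Σ|γ|^{-2} < ∞`). [Titchmarsh1986]
-/

noncomputable section

open MeasureTheory Set Filter Complex Topology
open scoped ComplexConjugate Real FourierTransform

namespace Literature.NumberTheory.LFunctions

namespace ZetaScrewNullSeries

variable {a : ℝ}

/-! ### A. Elementary bounds on the window -/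

/-- A non-trivial zero has `|Re(ρ − ½)| ≤ ½`. [folklore] -/
private theorem abs_re_sub_half_le (ρ : ZetaZeros.riemannZetaNontrivialZeros) :
    |((ρ : ℂ) - 1 / 2).re| ≤ 1 / 2 := by
  have h0 := ZetaZeros.riemannZetaNontrivialZeros.re_pos ρ.2
  have h1 := ZetaZeros.riemannZetaNontrivialZeros.re_lt_one ρ.2
  rw [abs_le, sub_re]
  norm_num
  constructor <;> linarith

/-- A non-trivial zero has `ρ − ½ ≠ 0`. [folklore] -/
private theorem sub_half_ne_zero (ρ : ZetaZeros.riemannZetaNontrivialZeros) : (ρ : ℂ) - 1 / 2 ≠ 0 := by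
  intro h
  have him := ZetaZeros.riemannZetaNontrivialZeros.im_ne_zero ρ.2
  have : ((ρ : ℂ) - 1 / 2).im = 0 := by rw [h, zero_im]
  rw [sub_im] at this
  norm_num at this
  exact him this

/-- `‖e^{vx}‖ ≤ e^{a/2}` for `|Re v| ≤ ½` and `|x| ≤ a`. [folklore] -/
private theorem norm_cexp_mul_le {v : ℂ} (hv : |v.re| ≤ 1 / 2) {x : ℝ} (hx : |x| ≤ a) :
    ‖cexp (v * x)‖ ≤ Real.exp (a / 2) := by
  rw [Complex.norm_exp, Real.exp_le_exp, re_mul_ofReal]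
  have ha : 0 ≤ a := (abs_nonneg x).trans hx
  calc v.re * x ≤ |v.re * x| := le_abs_self _
    _ = |v.re| * |x| := abs_mul _ _
    _ ≤ 1 / 2 * a := by gcongr
    _ = a / 2 := by ring

/-- `‖e^{vx} − 1‖ ≤ e^{a/2} + 1` for `|Re v| ≤ ½` and `|x| ≤ a`. [folklore] -/
private theorem norm_cexp_mul_sub_one_le {v : ℂ} (hv : |v.re| ≤ 1 / 2) {x : ℝ} (hx : |x| ≤ a) :
    ‖cexp (v * x) - 1‖ ≤ Real.exp (a / 2) + 1 := by
  calc ‖cexp (v * x) - 1‖ ≤ ‖cexp (v * x)‖ + ‖(1 : ℂ)‖ := norm_sub_le _ _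
    _ ≤ Real.exp (a / 2) + 1 := by rw [norm_one]; gcongr; exact norm_cexp_mul_le hv hx

/-- `‖1 − e^{−vx}‖ ≤ e^{a/2} + 1` for `|Re v| ≤ ½` and `|x| ≤ a`. [folklore] -/
private theorem norm_one_sub_cexp_neg_mul_le {v : ℂ} (hv : |v.re| ≤ 1 / 2) {x : ℝ} (hx : |x| ≤ a) :
    ‖1 - cexp (-v * x)‖ ≤ Real.exp (a / 2) + 1 := by
  rw [norm_sub_rev]
  exact norm_cexp_mul_sub_one_le (v := -v) (by simpa using hv) hx

/-- On `(−a, a)`: a.e. `|x| ≤ a`. [folklore] -/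
private theorem ae_abs_le : ∀ᵐ x ∂(volume.restrict (Ioo (-a) a)), |x| ≤ a :=
  (ae_restrict_mem measurableSet_Ioo).mono fun _ hx ↦ abs_le.2 ⟨hx.1.le, hx.2.le⟩

/-- Window transforms of an integrable `φ` against `e^{vu} − 1`, `|Re v| ≤ ½`:
`‖∫_{(−a,a)}(e^{vu} − 1)φ(u)du‖ ≤ (e^{a/2}+1)‖φ‖₁`. [folklore] -/
private theorem norm_integral_cexp_sub_one_mul_le {φ : ℝ → ℂ}
    (hφ : Integrable φ (volume.restrict (Ioo (-a) a))) {v : ℂ} (hv : |v.re| ≤ 1 / 2) :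
    ‖∫ u, (cexp (v * u) - 1) * φ u ∂(volume.restrict (Ioo (-a) a))‖ ≤
      (Real.exp (a / 2) + 1) * ∫ u, ‖φ u‖ ∂(volume.restrict (Ioo (-a) a)) := by
  rw [← integral_const_mul]
  refine norm_integral_le_of_norm_le (hφ.norm.const_mul _) (ae_abs_le.mono fun u hu ↦ ?_)
  rw [norm_mul]
  exact mul_le_mul_of_nonneg_right (norm_cexp_mul_sub_one_le hv hu) (norm_nonneg _)

/-! ### B. A continuous function vanishing a.e. on an open set vanishes there -/

/-- If `g` is continuous on an open set `U ⊆ ℝ` and `g = 0` a.e. on `U`, then `g = 0` on `U`. [folklore] -/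
private theorem eq_zero_of_continuousOn_of_ae {g : ℝ → ℂ} {U : Set ℝ} (hU : IsOpen U)
    (hg : ContinuousOn g U) (h : g =ᵐ[volume.restrict U] 0) : ∀ t ∈ U, g t = 0 := by
  intro t ht
  by_contra hne
  -- the set where `g ≠ 0` is relatively open in `U`, contains `t`, hence has positive measure
  obtain ⟨V, hVo, hVeq⟩ := (continuousOn_iff'.1 hg) ({0}ᶜ) isOpen_compl_singleton
  have htV : t ∈ V ∩ U := by
    rw [← hVeq]; exact ⟨hne, ht⟩
  have hopen : IsOpen (V ∩ U) := hVo.inter hU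
  have hpos : 0 < volume (V ∩ U) := hopen.measure_pos volume ⟨t, htV⟩
  -- but `g = 0` a.e. on `U`
  have hzero : volume (V ∩ U) = 0 := by
    have h' : ∀ᵐ x ∂volume, x ∈ U → g x = 0 := (ae_restrict_iff' hU.measurableSet).1 h
    have hsub : V ∩ U ⊆ {x | ¬ (x ∈ U → g x = 0)} := by
      intro x hx
      have hx' : x ∈ g ⁻¹' {0}ᶜ ∩ U := by rw [hVeq]; exact hx
      simp only [mem_setOf_eq, Classical.not_imp]
      exact ⟨hx.2, hx'.1⟩
    exact measure_mono_null hsub (ae_iff.1 h')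
  exact (hpos.ne' hzero).elim

/-! ### C. Exponential moments of a window-integrable function (§3.1/§6.2 of the source;
the same lemmas are private in `ZetaScrewLemma21Proofs.lean`, Part II) -/

/-- `t ↦ (e^{κt} − 1) h(t)` is integrable on `(−a,a)` for `h` integrable there. [folklore] -/
private theorem integrable_cexp_sub_one_mul (κ : ℂ) {h : ℝ → ℂ}
    (hh : Integrable h (volume.restrict (Ioo (-a) a))) :
    Integrable (fun x : ℝ ↦ (cexp (κ * x) - 1) * h x) (volume.restrict (Ioo (-a) a)) := by
  refine hh.bdd_mul (c := Real.exp (‖κ‖ * a) + 1) (Continuous.aestronglyMeasurable (by fun_prop))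
    (ae_abs_le.mono fun x hx ↦ ?_)
  calc ‖cexp (κ * x) - 1‖ ≤ ‖cexp (κ * x)‖ + ‖(1 : ℂ)‖ := norm_sub_le _ _
    _ ≤ Real.exp (‖κ‖ * a) + 1 := by
        rw [norm_one, Complex.norm_exp]
        gcongr
        calc (κ * x).re ≤ ‖κ * (x : ℂ)‖ := Complex.re_le_norm _
          _ = ‖κ‖ * |x| := by rw [norm_mul, Complex.norm_real, Real.norm_eq_abs]
          _ ≤ ‖κ‖ * a := by gcongr

/-- Differentiation under the integral sign: `D_φ(s) = ∫_{(−a,a)}(e^{su} − 1)φ(u)du` is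
complex-differentiable. [folklore] -/
private theorem hasDerivAt_expMoment {φ : ℝ → ℂ}
    (hφ : Integrable φ (volume.restrict (Ioo (-a) a))) (s₀ : ℂ) :
    HasDerivAt (fun s : ℂ ↦ ∫ u, (cexp (s * u) - 1) * φ u ∂(volume.restrict (Ioo (-a) a)))
      (∫ u, cexp (s₀ * u) * u * φ u ∂(volume.restrict (Ioo (-a) a))) s₀ := by
  refine (hasDerivAt_integral_of_dominated_loc_of_deriv_le (μ := volume.restrict (Ioo (-a) a))
    (F := fun s u ↦ (cexp (s * u) - 1) * φ u) (F' := fun s u ↦ cexp (s * u) * u * φ u)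
    (x₀ := s₀) (bound := fun u ↦ |a| * Real.exp ((‖s₀‖ + 1) * |a|) * ‖φ u‖)
    (Metric.ball_mem_nhds s₀ zero_lt_one) ?_ ?_ ?_ ?_ ?_ ?_).2
  · exact Eventually.of_forall fun s ↦ (integrable_cexp_sub_one_mul s hφ).aestronglyMeasurable
  · exact integrable_cexp_sub_one_mul s₀ hφ
  · exact (Continuous.aestronglyMeasurable (by fun_prop)).mul hφ.aestronglyMeasurable
  · refine ae_abs_le.mono fun u hu s hs ↦ ?_
    have hs' : ‖s‖ ≤ ‖s₀‖ + 1 := by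
      have := mem_ball_iff_norm.mp hs
      linarith [norm_le_norm_add_norm_sub' s s₀, norm_sub_rev s s₀]
    have hu' : |u| ≤ |a| := hu.trans (le_abs_self a)
    rw [norm_mul, norm_mul, Complex.norm_real, Real.norm_eq_abs, Complex.norm_exp]
    have hre : (s * u).re ≤ (‖s₀‖ + 1) * |a| := by
      calc (s * u).re ≤ ‖s * (u : ℂ)‖ := Complex.re_le_norm _
        _ = ‖s‖ * |u| := by rw [norm_mul, Complex.norm_real, Real.norm_eq_abs]
        _ ≤ (‖s₀‖ + 1) * |a| := by gcongr
    calc Real.exp (s * u).re * |u| * ‖φ u‖ ≤ Real.exp ((‖s₀‖ + 1) * |a|) * |a| * ‖φ u‖ := by gcongr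
      _ = |a| * Real.exp ((‖s₀‖ + 1) * |a|) * ‖φ u‖ := by ring
  · exact hφ.norm.const_mul _
  · refine Eventually.of_forall fun u s _ ↦ ?_
    have h1 : HasDerivAt (fun s : ℂ ↦ cexp (s * u)) (cexp (s * u) * u) s := by
      simpa using ((hasDerivAt_id s).mul_const (u : ℂ)).cexp
    exact (h1.sub_const 1).mul_const (φ u)

/-- `D_φ` is entire. [folklore] -/
private theorem differentiable_expMoment {φ : ℝ → ℂ}
    (hφ : Integrable φ (volume.restrict (Ioo (-a) a))) :
    Differentiable ℂ (fun s : ℂ ↦ ∫ u, (cexp (s * u) - 1) * φ u ∂(volume.restrict (Ioo (-a) a))) :=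
  fun s ↦ (hasDerivAt_expMoment hφ s).differentiableAt

/-- `|D_φ(s)| ≤ (e^{|s| a} + 1) ‖φ‖₁` (exponential type). [folklore] -/
private theorem norm_expMoment_le {φ : ℝ → ℂ}
    (hφ : Integrable φ (volume.restrict (Ioo (-a) a))) (s : ℂ) :
    ‖∫ u, (cexp (s * u) - 1) * φ u ∂(volume.restrict (Ioo (-a) a))‖ ≤
      (Real.exp (‖s‖ * a) + 1) * ∫ u, ‖φ u‖ ∂(volume.restrict (Ioo (-a) a)) := by
  rw [← integral_const_mul]
  refine norm_integral_le_of_norm_le (hφ.norm.const_mul _) (ae_abs_le.mono fun u hu ↦ ?_)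
  rw [norm_mul]
  refine mul_le_mul_of_nonneg_right ?_ (norm_nonneg _)
  calc ‖cexp (s * u) - 1‖ ≤ ‖cexp (s * u)‖ + ‖(1 : ℂ)‖ := norm_sub_le _ _
    _ ≤ Real.exp (‖s‖ * a) + 1 := by
        rw [norm_one, Complex.norm_exp]
        gcongr
        calc (s * u).re ≤ ‖s * (u : ℂ)‖ := Complex.re_le_norm _
          _ = ‖s‖ * |u| := by rw [norm_mul, Complex.norm_real, Real.norm_eq_abs]
          _ ≤ ‖s‖ * a := by gcongr

/-- If all exponential moments `∫_{(−a,a)}(e^{su} − 1)φ(u)du` vanish, then `φ = 0` a.e. on `(−a,a)`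
(Riemann–Lebesgue and Fourier uniqueness on `L¹`). [folklore] -/
private theorem ae_eq_zero_of_forall_expMoment {φ : ℝ → ℂ}
    (hφ : Integrable φ (volume.restrict (Ioo (-a) a)))
    (h : ∀ s : ℂ, ∫ u, (cexp (s * u) - 1) * φ u ∂(volume.restrict (Ioo (-a) a)) = 0) :
    φ =ᵐ[volume.restrict (Ioo (-a) a)] 0 := by
  set α : ℂ := ∫ u, φ u ∂(volume.restrict (Ioo (-a) a)) with hα
  have hmom : ∀ s : ℂ, ∫ u, cexp (s * u) * φ u ∂(volume.restrict (Ioo (-a) a)) = α := by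
    intro s
    have hs := h s
    have hsplit : ∫ u, (cexp (s * u) - 1) * φ u ∂(volume.restrict (Ioo (-a) a)) =
        (∫ u, cexp (s * u) * φ u ∂(volume.restrict (Ioo (-a) a))) - α := by
      rw [hα, ← integral_sub _ hφ]
      · congr 1; funext u; ring
      · exact hφ.bdd_mul (c := Real.exp (‖s‖ * a)) (Continuous.aestronglyMeasurable (by fun_prop))
          (ae_abs_le.mono fun u hu ↦ by
            rw [Complex.norm_exp]
            exact Real.exp_le_exp.mpr ((Complex.re_le_norm _).trans (by
              rw [norm_mul, Complex.norm_real, Real.norm_eq_abs]; gcongr)))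
    rw [hsplit] at hs
    exact (sub_eq_zero.mp hs)
  set f : ℝ → ℂ := (Ioo (-a) a).indicator φ with hf
  have hfi : Integrable f := (integrable_indicator_iff measurableSet_Ioo).mpr hφ
  have hF : ∀ ξ : ℝ, 𝓕 f ξ = α := by
    intro ξ
    rw [Real.fourier_real_eq_integral_exp_smul]
    have hpt : (fun v : ℝ ↦ cexp (↑(-2 * π * v * ξ) * I) • f v) =
        (Ioo (-a) a).indicator (fun v : ℝ ↦ cexp ((↑(-2 * π * ξ) * I) * v) * φ v) := by
      funext v
      rw [hf, smul_eq_mul]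
      by_cases hv : v ∈ Ioo (-a) a
      · rw [indicator_of_mem hv, indicator_of_mem hv]; congr 1; push_cast; ring_nf
      · rw [indicator_of_notMem hv, indicator_of_notMem hv, mul_zero]
    rw [hpt, integral_indicator measurableSet_Ioo]
    exact hmom _
  have hα0 : α = 0 := by
    have hRL := Real.zero_at_infty_fourier f
    rw [show 𝓕 f = fun _ ↦ α from funext hF] at hRL
    exact tendsto_const_nhds_iff.mp hRL
  have hf0 : f =ᵐ[volume] 0 :=
    Literature.Analysis.Fourier.ae_eq_zero_of_forall_fourier_eq_zero hfi fun ξ ↦ by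
      rw [hF, hα0]
  refine (ae_restrict_iff' measurableSet_Ioo).mpr (hf0.mono fun x hx hxS ↦ ?_)
  have : f x = φ x := by rw [hf, indicator_of_mem hxS]
  rw [← this]; exact hx

/-- **Lemma 2.1 applied** ("`w_γ ≠ 0` for some `γ` by Lemma 2.1, since `φ̂(z)` is a non-constant
entire function of the exponential type", §6.2): if the exponential moments
`D_φ(ρ − ½) = ∫_{(−a,a)}(e^{(ρ−½)u} − 1)φ(u)du` vanish at every non-trivial zero `ρ`, then `φ = 0` a.e.
on `(−a,a)`. [cite: Suzuki2023, §6.2 and Lemma 2.1, pp. 6, 16] -/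
theorem ae_eq_zero_of_forall_zero (h21 : Suzuki2023_lemma21) {φ : ℝ → ℂ}
    (hφ : Integrable φ (volume.restrict (Ioo (-a) a)))
    (h0 : ∀ ρ : ZetaZeros.riemannZetaNontrivialZeros,
      ∫ u, (cexp (((ρ : ℂ) - 1 / 2) * u) - 1) * φ u ∂(volume.restrict (Ioo (-a) a)) = 0) :
    φ =ᵐ[volume.restrict (Ioo (-a) a)] 0 := by
  set D : ℂ → ℂ := fun s ↦ ∫ u, (cexp (s * u) - 1) * φ u ∂(volume.restrict (Ioo (-a) a)) with hD
  have hDd : Differentiable ℂ D := differentiable_expMoment hφ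
  have hF : ∀ w : ℂ, D (-(I * w)) = 0 := by
    refine h21 (fun w ↦ D (-(I * w)))
      (hDd.comp ((differentiable_id.const_mul I).neg))
      ⟨2 * ∫ u, ‖φ u‖ ∂(volume.restrict (Ioo (-a) a)), |a|, fun w ↦ ?_⟩ 0 ?_
    · have hL : 0 ≤ ∫ u, ‖φ u‖ ∂(volume.restrict (Ioo (-a) a)) :=
        integral_nonneg fun _ ↦ norm_nonneg _
      have h1 := norm_expMoment_le hφ (-(I * w))
      have hn : ‖-(I * w)‖ = ‖w‖ := by rw [norm_neg, norm_mul, Complex.norm_I, one_mul]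
      rw [hn] at h1
      have he : Real.exp (‖w‖ * a) ≤ Real.exp (|a| * ‖w‖) := by
        rw [Real.exp_le_exp, mul_comm]; gcongr; exact le_abs_self a
      have he1 : 1 ≤ Real.exp (|a| * ‖w‖) := Real.one_le_exp (by positivity)
      calc ‖D (-(I * w))‖ ≤ (Real.exp (‖w‖ * a) + 1) * ∫ u, ‖φ u‖ ∂(volume.restrict (Ioo (-a) a)) := h1
        _ ≤ (2 * ∫ u, ‖φ u‖ ∂(volume.restrict (Ioo (-a) a))) * Real.exp (|a| * ‖w‖) := by
            nlinarith
    · intro γ hγ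
      have hmem := mem_riemannZetaNontrivialZeros_of_riemannXi_eq_zero hγ
      have h := h0 ⟨1 / 2 - I * γ, hmem⟩
      have he : ((1 / 2 - I * γ : ℂ)) - 1 / 2 = -(I * γ) := by ring
      simpa [hD, he] using h
  have hDall : ∀ s : ℂ, D s = 0 := fun s ↦ by
    have h := hF (I * s)
    have he : -(I * (I * s)) = s := by rw [← mul_assoc, Complex.I_mul_I]; ring
    rwa [he] at h
  exact ae_eq_zero_of_forall_expMoment hφ hDall

/-! ### D. The null series of a degenerate vector (§6.2) -/

/-- The hermitian form only sees the a.e.-class of its second argument on the window. [folklore] -/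
private theorem zetaScrewForm_congr_ae_right {S : Set ℝ} (hS : MeasurableSet S) (φ₁ : ℝ → ℂ)
    {φ₂ ψ : ℝ → ℂ} (h : φ₂ =ᵐ[volume.restrict S] ψ) :
    zetaScrewForm S φ₁ φ₂ = zetaScrewForm S φ₁ ψ := by
  rw [zetaScrewForm_eq_integral_zetaScrewOp hS, zetaScrewForm_eq_integral_zetaScrewOp hS]
  exact integral_congr_ae (h.mono fun t ht ↦ by simp only [ht])

/-- RH-FREE · **Suzuki2023 §6.2, the null series of a degenerate vector.** If, for some `0 < a`,
the form `⟨·,·⟩_{G_g,a}` is degenerate on `L²(−a,a)` — i.e. some `0 ≠ φ ∈ L²(−a,a)` has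
`⟨φ,φ₂⟩_{G_g,a} = 0` for all `φ₂ ∈ L²(−a,a)` (equivalently, `0` is an eigenvalue of `𝖦_g[a]`,
`Suzuki2023_thm14_eigenvalue_holds`) — then there is a non-identically vanishing sequence `{w_γ}`
with `Σ_γ w_γ (e^{iγt} − 1)/γ² = 0` on `(−a, a)`: in the tree's coordinates (`γ = i(ρ − ½)`),
`w(ρ) = m(ρ)·∫_{(−a,a)}(e^{(ρ−½)u} − 1)φ(u)du` (`= m(ρ)(φ̂(−γ) − φ̂(0))`, the printed `w_γ`) and
`Σ_ρ w(ρ)(1 − e^{−(ρ−½)t})/(ρ − ½)² = 0` for every `t ∈ (−a,a)` (a `HasSum`, absolutely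
convergent). Printed argument: "if `λ = 0`, we have `Σ_γ w_γ(e^{iγt} − 1)/γ² = 0` for `t ∈ (−a,a)` by
writing `w_γ = φ̂(−γ) − φ̂(0)`. Further, `w_γ ≠ 0` for some `γ` by Lemma 2.1, since `φ̂(z)` is a
non-constant entire function of the exponential type." Here: (3.1) (hypothesis `h301`, the printed statement; tree: `Suzuki2023_eq301`) gives
`Σ_ρ ∫ s_ρ(t) conj φ₂(t) dt = 0` for every `φ₂ ∈ L²(−a,a)`, `s_ρ(t) = w(ρ)(1 − e^{−(ρ−½)t})/(ρ−½)²`;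
termwise integration (`|s_ρ| ≪ m(ρ)/|ρ − ½|²` on the window) gives `∫ S conj φ₂ = 0` with
`S = Σ_ρ s_ρ` continuous, so `S = 0` on `(−a,a)` (take `φ₂ = S`); and `w ≠ 0` by Lemma 2.1
(hypothesis `h21`; tree: `Suzuki2023_lemma21_holds`) with Riemann–Lebesgue / Fourier uniqueness
(`ae_eq_zero_of_forall_zero`). [cite: Suzuki2023, §6.2 (p. 16) and Thm 6.1] -/
theorem exists_nullSeries_of_not_nondegenerate (h21 : Suzuki2023_lemma21)
    (h301 : ∀ {φ₁ φ₂ : ℝ → ℂ}, IntegrableOn φ₁ (Ioo (-a) a) → IntegrableOn φ₂ (Ioo (-a) a) →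
      HasSum (fun ρ : ZetaZeros.riemannZetaNontrivialZeros ↦ ((riemannZetaZeroOrder (ρ : ℂ) : ℂ) *
          ((∫ t in Ioo (-a) a, (cexp (-((ρ : ℂ) - 1 / 2) * t) - 1) * conj (φ₂ t)) *
            (∫ u in Ioo (-a) a, (cexp (((ρ : ℂ) - 1 / 2) * u) - 1) * φ₁ u)) /
          (-((ρ : ℂ) - 1 / 2) ^ 2))) (zetaScrewForm (Ioo (-a) a) φ₁ φ₂))
    (hdeg : ¬ IsScrewFormNondegenerate a) :
    ∃ w : ZetaZeros.riemannZetaNontrivialZeros → ℂ, w ≠ 0 ∧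
      ∀ t : ℝ, t ∈ Ioo (-a) a →
        HasSum (fun ρ : ZetaZeros.riemannZetaNontrivialZeros ↦
          w ρ * ((1 - cexp (-((ρ : ℂ) - 1 / 2) * t)) / ((ρ : ℂ) - 1 / 2) ^ 2)) 0 := by
  classical
  obtain ⟨φ₁, hφ₁, hφ₁0⟩ : ∃ φ₁ : Lp ℂ 2 (volume.restrict (Ioo (-a) a)),
      (∀ φ₂ : Lp ℂ 2 (volume.restrict (Ioo (-a) a)), zetaScrewForm (Ioo (-a) a) φ₁ φ₂ = 0) ∧
        φ₁ ≠ 0 := by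
    by_contra hcon
    refine hdeg fun φ₁ hφ₁ ↦ ?_
    by_contra h0
    exact hcon ⟨φ₁, hφ₁, h0⟩
  set φ : ℝ → ℂ := (φ₁ : ℝ → ℂ) with hφdef
  have hφ2 : MemLp φ 2 (volume.restrict (Ioo (-a) a)) := Lp.memLp φ₁
  have hφi : Integrable φ (volume.restrict (Ioo (-a) a)) := hφ2.integrable one_le_two
  -- the coefficients
  set B : ZetaZeros.riemannZetaNontrivialZeros → ℂ :=
    fun ρ ↦ ∫ u, (cexp (((ρ : ℂ) - 1 / 2) * u) - 1) * φ u ∂(volume.restrict (Ioo (-a) a)) with hB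
  set w : ZetaZeros.riemannZetaNontrivialZeros → ℂ :=
    fun ρ ↦ (riemannZetaZeroOrder (ρ : ℂ) : ℂ) * B ρ with hw
  set s : ZetaZeros.riemannZetaNontrivialZeros → ℝ → ℂ :=
    fun ρ t ↦ w ρ * ((1 - cexp (-((ρ : ℂ) - 1 / 2) * t)) / ((ρ : ℂ) - 1 / 2) ^ 2) with hs
  set L : ℝ := ∫ u, ‖φ u‖ ∂(volume.restrict (Ioo (-a) a)) with hL
  have hL0 : 0 ≤ L := integral_nonneg fun _ ↦ norm_nonneg _
  set K : ℝ := Real.exp (a / 2) + 1 with hK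
  have hK0 : 0 ≤ K := by positivity
  -- the majorant `C(ρ) = m(ρ)/‖ρ − ½‖² · K² L`
  set C : ZetaZeros.riemannZetaNontrivialZeros → ℝ :=
    fun ρ ↦ (riemannZetaZeroOrder (ρ : ℂ) : ℝ) / ‖(ρ : ℂ) - 1 / 2‖ ^ 2 * (K * L * K) with hC
  have hCsum : Summable C := ZetaScrewProp31.summable_zeroOrder_div_norm_sub_half_sq.mul_right _
  have hB_le : ∀ ρ, ‖B ρ‖ ≤ K * L := fun ρ ↦
    norm_integral_cexp_sub_one_mul_le hφi (abs_re_sub_half_le ρ)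
  have hs_le : ∀ ρ, ∀ t : ℝ, |t| ≤ a → ‖s ρ t‖ ≤ C ρ := by
    intro ρ t ht
    have hm : (0 : ℝ) ≤ riemannZetaZeroOrder (ρ : ℂ) := (FordL33.order_pos ρ).le
    have hκ := sub_half_ne_zero ρ
    have h1 := norm_one_sub_cexp_neg_mul_le (abs_re_sub_half_le ρ) ht
    simp only [hs, hw, hC]
    rw [norm_mul, norm_mul, norm_div, norm_pow, Complex.norm_intCast, abs_of_nonneg hm]
    rw [show (riemannZetaZeroOrder (ρ : ℂ) : ℝ) * ‖B ρ‖ * (‖1 - cexp (-((ρ : ℂ) - 1 / 2) * t)‖ /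
        ‖(ρ : ℂ) - 1 / 2‖ ^ 2) = (riemannZetaZeroOrder (ρ : ℂ) : ℝ) / ‖(ρ : ℂ) - 1 / 2‖ ^ 2 *
        (‖B ρ‖ * ‖1 - cexp (-((ρ : ℂ) - 1 / 2) * t)‖) by ring]
    refine mul_le_mul_of_nonneg_left ?_ (by positivity)
    exact mul_le_mul (hB_le ρ) h1 (norm_nonneg _) (mul_nonneg hK0 hL0)
  -- the sum function `S` and its continuity on `[−a, a]`
  set Sf : ℝ → ℂ := fun t ↦ ∑' ρ, s ρ t with hSf
  have hs_cont : ∀ ρ, Continuous (s ρ) := fun ρ ↦ by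
    simp only [hs]
    fun_prop
  have hS_hasSum : ∀ t : ℝ, |t| ≤ a → HasSum (fun ρ ↦ s ρ t) (Sf t) := fun t ht ↦
    (Summable.of_norm_bounded hCsum (fun ρ ↦ hs_le ρ t ht)).hasSum
  have hS_cont : ContinuousOn Sf (Icc (-a) a) := by
    refine continuousOn_tsum (fun ρ ↦ (hs_cont ρ).continuousOn) hCsum fun ρ t ht ↦ ?_
    exact hs_le ρ t (abs_le.2 ⟨by linarith [ht.1], ht.2⟩)
  have hS_meas : AEStronglyMeasurable Sf (volume.restrict (Ioo (-a) a)) :=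
    (hS_cont.mono Ioo_subset_Icc_self).aestronglyMeasurable measurableSet_Ioo
  have hS_bdd : ∀ᵐ t ∂(volume.restrict (Ioo (-a) a)), ‖Sf t‖ ≤ ∑' ρ, C ρ := ae_abs_le.mono fun t ht ↦
    (hS_hasSum t ht).norm_le_of_bounded hCsum.hasSum (fun ρ ↦ hs_le ρ t ht)
  -- (1) termwise integration against any integrable `ψ`
  have hterm : ∀ {ψ : ℝ → ℂ}, Integrable ψ (volume.restrict (Ioo (-a) a)) →
      HasSum (fun ρ ↦ ∫ t, s ρ t * conj (ψ t) ∂(volume.restrict (Ioo (-a) a))) (∫ t, Sf t * conj (ψ t) ∂(volume.restrict (Ioo (-a) a))) := by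
    intro ψ hψ
    have hψc : Integrable (fun t ↦ conj (ψ t)) (volume.restrict (Ioo (-a) a)) :=
      (LinearIsometryEquiv.integrable_comp_iff Complex.conjLIE).mpr hψ
    refine hasSum_integral_of_dominated_convergence (fun ρ t ↦ C ρ * ‖ψ t‖)
      (fun ρ ↦ ((hs_cont ρ).aestronglyMeasurable).mul hψc.aestronglyMeasurable)
      (fun ρ ↦ ae_abs_le.mono fun t ht ↦ ?_) ?_ ?_ ?_
    · rw [norm_mul, Complex.norm_conj]
      exact mul_le_mul_of_nonneg_right (hs_le ρ t ht) (norm_nonneg _)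
    · exact Eventually.of_forall fun t ↦ hCsum.mul_right _
    · simp_rw [tsum_mul_right]
      exact hψ.norm.const_mul _
    · exact ae_abs_le.mono fun t ht ↦ (hS_hasSum t ht).mul_right _
  -- (2) for `ψ ∈ L²(−a,a)`: `∫ S conj ψ = 0`
  have hzero : ∀ {ψ : ℝ → ℂ}, MemLp ψ 2 (volume.restrict (Ioo (-a) a)) → ∫ t, Sf t * conj (ψ t) ∂(volume.restrict (Ioo (-a) a)) = 0 := by
    intro ψ hψ2
    have hψ : Integrable ψ (volume.restrict (Ioo (-a) a)) := hψ2.integrable one_le_two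
    -- `⟨φ, ψ⟩ = 0`
    have hform : zetaScrewForm (Ioo (-a) a) φ ψ = 0 := by
      have h := hφ₁ (hψ2.toLp ψ)
      rw [zetaScrewForm_congr_ae_right measurableSet_Ioo _ (MemLp.coeFn_toLp hψ2)] at h
      exact h
    -- (3.1): `Σ_ρ ∫ s_ρ conj ψ = ⟨φ, ψ⟩ = 0`
    have h301 := h301 (φ₁ := φ) (φ₂ := ψ) hφi hψ
    rw [hform] at h301
    have h301' : HasSum (fun ρ ↦ ∫ t, s ρ t * conj (ψ t) ∂(volume.restrict (Ioo (-a) a))) 0 := by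
      refine h301.congr_fun fun ρ ↦ ?_
      have e : (fun t : ℝ ↦ s ρ t * conj (ψ t)) = fun t : ℝ ↦
          (-(w ρ / ((ρ : ℂ) - 1 / 2) ^ 2)) * ((cexp (-((ρ : ℂ) - 1 / 2) * t) - 1) * conj (ψ t)) := by
        funext t; simp only [hs]; ring
      rw [e, integral_const_mul]
      simp only [hw, hB, div_neg]
      ring
    exact (hterm hψ).unique h301'
  -- (3) `ψ := S`: `∫ |S|² = 0`, so `S = 0` a.e., so `S = 0` on `(−a,a)`
  have hS2 : MemLp Sf 2 (volume.restrict (Ioo (-a) a)) := MemLp.of_bound hS_meas _ hS_bdd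
  have hSS := hzero hS2
  have hnormsq : ∫ t, (‖Sf t‖ ^ 2 : ℝ) ∂(volume.restrict (Ioo (-a) a)) = 0 := by
    have e : (fun t ↦ Sf t * conj (Sf t)) = fun t ↦ ((‖Sf t‖ ^ 2 : ℝ) : ℂ) := by
      funext t; rw [Complex.mul_conj, Complex.normSq_eq_norm_sq]
    rw [e, integral_complex_ofReal] at hSS
    exact_mod_cast hSS
  have hS_ae : Sf =ᵐ[volume.restrict (Ioo (-a) a)] 0 := by
    have hint : Integrable (fun t ↦ ‖Sf t‖ ^ 2) (volume.restrict (Ioo (-a) a)) := (hS2.integrable_norm_rpow two_ne_zero ENNReal.ofNat_ne_top).congr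
      (Eventually.of_forall fun t ↦ by simp)
    have h := (integral_eq_zero_iff_of_nonneg (fun t ↦ by positivity) hint).1 hnormsq
    exact h.mono fun t ht ↦ by simpa using ht
  have hS0 : ∀ t ∈ Ioo (-a) a, Sf t = 0 :=
    eq_zero_of_continuousOn_of_ae isOpen_Ioo (hS_cont.mono Ioo_subset_Icc_self) hS_ae
  -- (4) `w ≠ 0` by Lemma 2.1
  have hw0 : w ≠ 0 := by
    intro hw0
    have hB0 : ∀ ρ, B ρ = 0 := fun ρ ↦ by
      have h := congrFun hw0 ρ
      simp only [hw, Pi.zero_apply, mul_eq_zero] at h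
      rcases h with h | h
      · exfalso
        have := FordL33.order_pos ρ
        have h' : (riemannZetaZeroOrder (ρ : ℂ) : ℝ) = 0 := by exact_mod_cast h
        linarith
      · exact h
    have hae := ae_eq_zero_of_forall_zero h21 hφi hB0
    exact hφ₁0 (Lp.eq_zero_iff_ae_eq_zero.mpr hae)
  refine ⟨w, hw0, fun t ht ↦ ?_⟩
  have habs : |t| ≤ a := abs_le.2 ⟨ht.1.le, ht.2.le⟩
  have h := hS_hasSum t habs
  rw [hS0 t ht] at h
  exact h

end ZetaScrewNullSeries

end Literature.NumberTheory.LFunctions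

end
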